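import Summits.QuantumFields.YangMills.Theses.RevelationMartingale

/-!
# Route RevelationMartingale — glue of the depth split of `MeanDeviationL` (stmt-QuantumFields-23135)

`MeanDeviationShallowL → MeanDeviationDeepL → MeanDeviationL` (critic #137 price 1): for each `L` take the shallow depth
fraction `N₁`, the two `γ₁`'s and their minimum, and decide each `(K, j)` by whether `N₁·j ≤ K`.  Pure logic; no summit
and no rung is proved here. [folklore]
-/

namespace Summit.QuantumFields.YangMills.Theorems

open Summit.QuantumFields.YangMills.Theses.RevelationMartingale in
/-- `MeanDeviationLGlue` (stmt-QuantumFields-23135): the depth split recomposes. [folklore] -/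
theorem revelationMartingale_meanDeviationLGlue_proof :
    Summit.QuantumFields.YangMills.Theses.RevelationMartingale.MeanDeviationLGlue := by
  intro hS hD L b₀ p₀ hb₀ hp₀
  obtain ⟨N₁, hN₁, hSL⟩ := hS L
  obtain ⟨γa, hγa, hγa1, hFa⟩ := hSL b₀ p₀ hb₀ hp₀
  obtain ⟨γb, hγb, hγb1, hFb⟩ := hD L N₁ hN₁ b₀ p₀ hb₀ hp₀
  refine ⟨min γa γb, lt_min hγa hγb, (min_le_left _ _).trans hγa1, ?_⟩
  intro F γ hL hγ hγle K j hj hjK p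
  by_cases hdepth : N₁ * j ≤ K
  · exact hFa F γ hL hγ (hγle.trans (min_le_left _ _)) K j hj hdepth p
  · exact hFb F γ hL hγ (hγle.trans (min_le_right _ _)) K j hj hjK (Nat.lt_of_not_le hdepth) p

end Summit.QuantumFields.YangMills.Theorems
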